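import Summits.ResolutionOfSingularities.ResolutionOfSingularities.Theorems.WeightedInvariantDescentPerfectToAllDescendResolutionProps
import Literature.AlgebraicGeometry.Resolution.ResolutionOfComponents
import Literature.AlgebraicGeometry.Resolution.PrincipalizationToResolution
import Literature.AlgebraicGeometry.Morphisms.RefinedValuativeCriterionDense
import Mathlib.AlgebraicGeometry.Morphisms.ClosedImmersion
import Mathlib.AlgebraicGeometry.Morphisms.UniversallyInjective
import Mathlib.AlgebraicGeometry.Morphisms.Integral
import Mathlib.AlgebraicGeometry.IdealSheaf.IrreducibleComponent
import Mathlib.AlgebraicGeometry.Noetherian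
import Mathlib.CategoryTheory.Limits.Shapes.Pullback.Pasting
import Mathlib.FieldTheory.PurelyInseparable.PerfectClosure
import Mathlib.Topology.Homeomorph.Lemmas
import HarnessLib

/-!
# `WeightedInvariant.DescentPerfectToAll`, line `root-of-a-constant`: reduction to integral `X`

Route `ResolutionOfSingularities/WeightedInvariant`, crux `DescentPerfectToAll`
(stmt-ResolutionOfSingularities-0549), stub `stub_oneRootReduceToIntegral` (R1) of the lead's
skeleton, PROVED here (statement verbatim from the ledger registration).

**Statement.** Fix a prime `p`. The ONE-ROOT STEP for a class of `k`-schemes `X` says: for all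
fields `k ⊆ K = k(α)` of characteristic `p` with `α ^ p = a ∈ k ∖ k ^ p`, every separated
`k`-scheme of finite type `f : X → Spec k` in the class and every surjective closed immersion
`ι : Z ↪ X_K = X ×_k Spec K` from a reduced scheme `Z` (so `Z = (X_K)_red`), a resolution of `Z`
yields a resolution of `X`. If the one-root step holds for INTEGRAL `X`, it holds for REDUCED `X`.

**Proof.**
* `X` is Noetherian, so it suffices to resolve each irreducible component `C` with its reduced
  (integral) closed-subscheme structure `j : X_C ↪ X` (`hasResolution_of_irreducibleComponents`,
  Cossart–Piltant 2019, proof of Prop. 4.6, Step 1).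
* Apply the integral one-root step to `X_C → Spec k` with `Z_C = ((X_C)_K)_red ↪ (X_C)_K`. It
  remains to resolve `Z_C`.
* `Spec K → Spec k` is surjective, integral (universally closed) and radicial (`K / k` is purely
  inseparable), so `q : X_K → X` and `φ = ι ≫ q : Z → X` are continuous closed bijections, i.e.
  homeomorphisms; the reduced `Z_C` embeds into `Z` by a closed immersion `n` (lift of
  `Z_C ↪ (X_C)_K ↪ X_K` through `ι`, which kills only nilpotents) with range `φ⁻¹(C)`, an
  irreducible component of `Z`; in particular `Z_C` is integral.
* **A resolution of a Noetherian scheme `Z` restricts to a resolution of every integral closed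
  subscheme `X' ↪ Z` supported on an irreducible component `D`**
  (`hasResolution_of_isClosedImmersion_of_range_mem_irreducibleComponents`): if `π : Y → Z` is a
  resolution, an isomorphism over the dense open `U`, then the generic point `ξ` of `D` lies in
  `U`, so `ξ = π(y₀)`; the irreducible component `W₀` of the regular Noetherian `Y` through `y₀`
  is open and closed, regular, and `π(W₀) ⊆ D` by maximality of `D`; Kollár's "first centre
  through the generic point" lemma (`hasResolution_of_centre_through_genericPoint`,
  `PrincipalizationToResolution.lean`) then produces the resolution `W₀ → X'`.

The geometric argument is recorded for an arbitrary surjective, universally closed, universally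
injective base extension `S' → Spec k` (`hasResolution_of_forall_isIntegral_of_radicial`); the
stub is the case `S' = Spec K` (`isPurelyInseparable_of_pow_eq`,
`universallyClosed_SpecMap_of_isPurelyInseparable`, and
`universallyInjective_SpecMap_of_isPurelyInseparable` of the landed `…DescendResolutionProps`).
-/

set_option linter.dupNamespace false -- mandated namespace of this single-conjunct summit

noncomputable section

open CategoryTheory CategoryTheory.Limits AlgebraicGeometry TopologicalSpace Topology
open Literature.AlgebraicGeometry.Resolution Literature.AlgebraicGeometry.Morphisms

namespace Summit.ResolutionOfSingularities.ResolutionOfSingularities.Theorems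

universe u

/-! ## Resolutions restrict to irreducible components -/

/-- **A resolution restricts to each irreducible component.** Let `Z` be a Noetherian scheme
admitting a resolution of singularities and `i : X' ↪ Z` a closed immersion of an integral
scheme whose image is an irreducible component `D` of `Z`. Then `X'` admits a resolution: for a
resolution `π : Y → Z`, an isomorphism over the dense open `U ∋ ξ_D`, the irreducible component of
the regular scheme `Y` through a point over `ξ_D` is open and closed and maps into `D`, and
`hasResolution_of_centre_through_genericPoint` applies. [folklore] -/
theorem hasResolution_of_isClosedImmersion_of_range_mem_irreducibleComponents
    {Z X' : Scheme.{u}} [IsNoetherian Z] (hZ : Scheme.HasResolution Z) [IsIntegral X']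
    (i : X' ⟶ Z) [IsClosedImmersion i]
    (hi : Set.range i ∈ irreducibleComponents (Z : Type u)) : Scheme.HasResolution X' := by
  obtain ⟨Y, π, hprop, ⟨U, hU, -, hiso⟩, hreg⟩ := hZ
  haveI := hprop
  -- `Y` is Noetherian
  haveI : IsLocallyNoetherian Y := LocallyOfFiniteType.isLocallyNoetherian π
  haveI : CompactSpace Y := QuasiCompact.compactSpace_of_compactSpace π
  haveI : IsNoetherian Y := {}
  -- the generic point `ξ = i η` of the component `D = i(X')` lies in `U`
  have hξU : i (genericPoint X') ∈ U := by
    obtain ⟨o, ho, hone, hoD⟩ :=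
      NoetherianSpace.exists_isOpen_nonempty_subset_irreducibleComponent _ hi
    obtain ⟨x, hxo, hxU⟩ := hU.inter_open_nonempty o ho hone
    obtain ⟨x', rfl⟩ := hoD hxo
    exact ((genericPoint_specializes x').map i.continuous).mem_open U.2 hxU
  -- a point `y₀` of `Y` over `ξ`
  obtain ⟨y₀, hy₀⟩ : ∃ y₀ : Y, π y₀ = i (genericPoint X') := by
    obtain ⟨y, hy⟩ := (π ∣_ U).surjective ⟨i (genericPoint X'), hξU⟩
    exact ⟨y.1, by rw [← morphismRestrict_base_coe, hy]⟩
  -- the component `W₀` of `Y` through `y₀`: open and closed, regular, Noetherian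
  have hC₀ : irreducibleComponent y₀ ∈ irreducibleComponents Y :=
    irreducibleComponent_mem_irreducibleComponents y₀
  set W₀ : Y.Opens := Y.irreducibleComponentOpen (irreducibleComponent y₀) with hW₀def
  have hW₀ : (W₀ : Set Y) = irreducibleComponent y₀ := hreg.coe_irreducibleComponentOpen hC₀
  have hy₀W₀ : y₀ ∈ W₀ := by
    rw [← SetLike.mem_coe, hW₀]; exact mem_irreducibleComponent
  haveI : IsClosedImmersion W₀.ι := IsClosedImmersion.of_isPreimmersion _ (by
    rw [Scheme.Opens.range_ι, hW₀]; exact isClosed_irreducibleComponent)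
  haveI : IsLocallyNoetherian (W₀ : Scheme.{u}) := LocallyOfFiniteType.isLocallyNoetherian W₀.ι
  haveI : CompactSpace (W₀ : Scheme.{u}) := QuasiCompact.compactSpace_of_compactSpace W₀.ι
  haveI : IsNoetherian (W₀ : Scheme.{u}) := {}
  refine hasResolution_of_centre_through_genericPoint i π W₀.ι (hreg.of_isOpenImmersion W₀.ι)
    hξU hiso ⟨⟨y₀, hy₀W₀⟩, ?_⟩ ?_
  · rw [Scheme.Hom.comp_apply, Scheme.Opens.ι_apply, hy₀]
  · -- `π(W₀) ⊆ D` by maximality of the component `D`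
    have hirr : IsIrreducible (closure (π '' irreducibleComponent y₀)) :=
      (isIrreducible_irreducibleComponent.image π π.continuous.continuousOn).closure
    have hD : Set.range i ⊆ closure (π '' irreducibleComponent y₀) := by
      have h3 : Set.range i ⊆ closure {i (genericPoint X')} := by
        rw [← Set.image_univ, ← genericPoint_closure, ← Set.image_singleton]
        exact image_closure_subset_closure_image i.continuous
      refine h3.trans (closure_mono (Set.singleton_subset_iff.mpr ?_))
      exact ⟨y₀, mem_irreducibleComponent, hy₀⟩
    have hle : closure (π '' irreducibleComponent y₀) ⊆ Set.range i := hi.2 hirr hD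
    rintro _ ⟨w, rfl⟩
    refine hle (subset_closure ⟨W₀.ι w, ?_, (Scheme.Hom.comp_apply _ _ _).symm⟩)
    rw [← hW₀, Scheme.Opens.ι_apply]
    exact w.2

/-! ## Topology of the base change along a purely inseparable extension -/

/-- For `K / k` purely inseparable, `Spec K → Spec k` is universally closed (it is integral).
[folklore] -/
theorem universallyClosed_SpecMap_of_isPurelyInseparable (k K : Type u) [Field k] [Field K]
    [Algebra k K] [IsPurelyInseparable k K] :
    UniversallyClosed (Spec.map (CommRingCat.ofHom (algebraMap k K))) := by
  haveI : IsIntegralHom (Spec.map (CommRingCat.ofHom (algebraMap k K))) := by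
    rw [IsIntegralHom.SpecMap_iff, CommRingCat.hom_ofHom]
    exact algebraMap_isIntegral_iff.mpr inferInstance
  infer_instance

/-- `k(α) / k` with `α ^ p ∈ k` (`char k = p`) is purely inseparable. [folklore] -/
theorem isPurelyInseparable_of_pow_eq {p : ℕ} [Fact p.Prime] {k K : Type u} [Field k] [Field K]
    [Algebra k K] [CharP k p] (a : k) (α : K) (hα : α ^ p = algebraMap k K a)
    (htop : IntermediateField.adjoin k {α} = ⊤) : IsPurelyInseparable k K := by
  rw [isPurelyInseparable_iff_perfectClosure_eq_top, eq_top_iff, ← htop,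
    IntermediateField.adjoin_simple_le_iff, mem_perfectClosure_iff_pow_mem p]
  exact ⟨1, a, by rw [pow_one, hα]⟩

/-! ## The reduction for a fixed radicial base extension -/

/-- **The reduction, geometric form.** Let `g : S' → Spec k` be surjective, universally closed and
universally injective (e.g. `Spec K → Spec k` for `K / k` purely inseparable) with `S'`
Noetherian. If every integral separated `k`-scheme of finite type `X` is resolved as soon as the
reduction of `X ×_{Spec k} S'` is, then the same holds for every reduced separated `k`-scheme of
finite type: resolve the components `X_C` (`hasResolution_of_irreducibleComponents`), feeding the
integral case with `Z_C = ((X_C) ×_{Spec k} S')_red`, an integral closed subscheme of `Z`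
supported on the component `φ⁻¹(C)` of `Z` (`φ : Z ↪ X ×_{Spec k} S' → X` is a homeomorphism),
which is resolved by `hasResolution_of_isClosedImmersion_of_range_mem_irreducibleComponents`.
[folklore] -/
theorem hasResolution_of_forall_isIntegral_of_radicial {k : Type u} [Field k] {S' : Scheme.{u}}
    (g : S' ⟶ Spec (.of k)) [Surjective g] [UniversallyClosed g] [UniversallyInjective g]
    [IsLocallyNoetherian S'] [CompactSpace S']
    (hint : ∀ (X : Scheme.{u}) (f : X ⟶ Spec (.of k)), IsSeparated f → LocallyOfFiniteType f →
      QuasiCompact f → IsIntegral X → ∀ (Z : Scheme.{u}) (ι : Z ⟶ pullback f g),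
      IsClosedImmersion ι → Surjective ι → IsReduced Z → Scheme.HasResolution Z →
      Scheme.HasResolution X)
    (X : Scheme.{u}) (f : X ⟶ Spec (.of k)) [IsSeparated f] [LocallyOfFiniteType f]
    [QuasiCompact f] [IsReduced X] {Z : Scheme.{u}} (ι : Z ⟶ pullback f g) [IsClosedImmersion ι]
    [Surjective ι] [IsReduced Z] (hZ : Scheme.HasResolution Z) : Scheme.HasResolution X := by
  -- the projection `q : X ×_k S' → X` is a continuous closed bijection
  haveI : Surjective (pullback.fst f g) := MorphismProperty.pullback_fst _ _ inferInstance
  haveI : UniversallyClosed (pullback.fst f g) := MorphismProperty.pullback_fst _ _ inferInstance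
  haveI : UniversallyInjective (pullback.fst f g) :=
    MorphismProperty.pullback_fst _ _ inferInstance
  -- `φ = ι ≫ q : Z → X` is a homeomorphism
  have hφ : IsHomeomorph (ι ≫ pullback.fst f g) := by
    refine isHomeomorph_iff_continuous_isClosedMap_bijective.mpr
      ⟨(ι ≫ pullback.fst f g).continuous, (ι ≫ pullback.fst f g).isClosedMap, ?_,
        (ι ≫ pullback.fst f g).surjective⟩
    intro x y hxy
    rw [Scheme.Hom.comp_apply, Scheme.Hom.comp_apply] at hxy
    exact ι.isClosedEmbedding.injective ((pullback.fst f g).injective hxy)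
  -- `X` and `Z` are Noetherian
  haveI : IsLocallyNoetherian X := LocallyOfFiniteType.isLocallyNoetherian f
  haveI : CompactSpace X := QuasiCompact.compactSpace_of_compactSpace f
  haveI : IsNoetherian X := {}
  haveI : IsLocallyNoetherian Z := LocallyOfFiniteType.isLocallyNoetherian (ι ≫ pullback.snd f g)
  haveI : CompactSpace Z := QuasiCompact.compactSpace_of_compactSpace (ι ≫ pullback.snd f g)
  haveI : IsNoetherian Z := {}
  -- resolve the irreducible components of `X`
  refine hasResolution_of_irreducibleComponents X
    TopologicalSpace.NoetherianSpace.finite_irreducibleComponents fun C hC => ?_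
  haveI hXC : IsIntegral (Scheme.IdealSheafData.vanishingIdeal C).subscheme :=
    isIntegral_subscheme_of_mem_irreducibleComponents C hC
  set j := (Scheme.IdealSheafData.vanishingIdeal C).subschemeι with hjdef
  have hjrange : Set.range j = (C : Set X) := range_subschemeι_vanishingIdeal C
  -- `(X_C) ×_k S'`, its reduction `Z_C`, and the closed immersion `m : (X_C) ×_k S' ↪ X ×_k S'`
  set ιC := (pullback (j ≫ f) g).nilradical.subschemeι with hιCdef
  set m : pullback (j ≫ f) g ⟶ pullback f g :=
    (pullbackRightPullbackFstIso f g j).inv ≫ pullback.snd j (pullback.fst f g) with hmdef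
  have hmrange : Set.range m = pullback.fst f g ⁻¹' (C : Set X) := by
    rw [hmdef, Scheme.Hom.comp_base, TopCat.coe_comp, Set.range_comp,
      (pullbackRightPullbackFstIso f g j).inv.surjective.range_eq, Set.image_univ,
      Scheme.Pullback.range_snd, hjrange]
  -- `n : Z_C ↪ Z`, the lift of `Z_C ↪ (X_C) ×_k S' ↪ X ×_k S'` through `ι`
  have hker : ι.ker ≤ (ιC ≫ m).ker := by
    refine le_trans ?_ (nilradical_le_ker (ιC ≫ m))
    rw [← Scheme.IdealSheafData.vanishingIdeal_top (X := pullback f g),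
      ← Scheme.IdealSheafData.le_support_iff_le_vanishingIdeal]
    intro x _
    rw [← SetLike.mem_coe, Scheme.Hom.support_ker, ι.surjective.range_eq, closure_univ]
    trivial
  set n := IsClosedImmersion.lift ι (ιC ≫ m) hker with hndef
  have hn : n ≫ ι = ιC ≫ m := IsClosedImmersion.lift_fac _ _ _
  haveI : IsClosedImmersion n := by
    have : IsClosedImmersion (n ≫ ι) := by rw [hn]; infer_instance
    exact IsClosedImmersion.of_comp_isClosedImmersion n ι
  have hnrange : Set.range n = (ι ≫ pullback.fst f g) ⁻¹' (C : Set X) := by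
    ext z
    constructor
    · rintro ⟨w, rfl⟩
      rw [Set.mem_preimage, Scheme.Hom.comp_apply, ← Scheme.Hom.comp_apply n ι, hn,
        ← Set.mem_preimage, ← hmrange, Scheme.Hom.comp_apply]
      exact ⟨_, rfl⟩
    · intro hz
      have hz' : ι z ∈ Set.range m := by
        rw [hmrange, Set.mem_preimage, ← Scheme.Hom.comp_apply]; exact hz
      obtain ⟨w', hw'⟩ := hz'
      obtain ⟨w, rfl⟩ := ιC.surjective w'
      refine ⟨w, ι.isClosedEmbedding.injective ?_⟩
      rw [← Scheme.Hom.comp_apply, hn, Scheme.Hom.comp_apply, hw']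
  have hncomp : Set.range n ∈ irreducibleComponents (Z : Type u) := by
    rw [hnrange]
    refine preimage_mem_irreducibleComponents hC hφ.isOpenEmbedding ?_
    rw [hφ.surjective.range_eq, Set.inter_univ]
    exact hC.1.nonempty
  -- `Z_C` is integral and has a resolution
  haveI : IrreducibleSpace (pullback (j ≫ f) g).nilradical.subscheme := by
    haveI : IrreducibleSpace (Set.range n) := Subtype.irreducibleSpace hncomp.1
    exact (n.isClosedEmbedding.isEmbedding.toHomeomorph.irreducibleSpace_iff).mpr inferInstance
  haveI : IsIntegral (pullback (j ≫ f) g).nilradical.subscheme :=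
    isIntegral_of_irreducibleSpace_of_isReduced _
  have hZC : Scheme.HasResolution (pullback (j ≫ f) g).nilradical.subscheme :=
    hasResolution_of_isClosedImmersion_of_range_mem_irreducibleComponents hZ n hncomp
  exact hint _ (j ≫ f) inferInstance inferInstance inferInstance hXC _ ιC inferInstance
    inferInstance inferInstance hZC

/-! ## The stub -/

/-- STUB `stub_oneRootReduceToIntegral` (R1): the one-root-of-a-constant step for INTEGRAL
`X` implies it for REDUCED `X` — `K = k(α)` with `α ^ p ∈ k` is purely inseparable over `k`, so
`Spec K → Spec k` is surjective, universally closed and universally injective, and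
`hasResolution_of_forall_isIntegral_of_radicial` applies: resolve each irreducible component `X_C`
of `X` by the integral step fed with `Z_C = ((X_C)_K)_red`, an integral closed subscheme of
`Z = (X_K)_red` supported on an irreducible component, resolved by restricting the given
resolution of `Z`, and glue (`hasResolution_of_irreducibleComponents`). [folklore] -/
theorem stub_oneRootReduceToIntegral : ∀ (p : ℕ) [Fact p.Prime], (∀ (k K : Type) [Field k] [Field K] [Algebra k K] [CharP k p] (a : k) (α : K), (∀ b : k, b ^ p ≠ a) → α ^ p = algebraMap k K a → IntermediateField.adjoin k {α} = ⊤ → ∀ (X : Scheme.{0}) (f : X ⟶ Spec (.of k)), IsSeparated f → LocallyOfFiniteType f → QuasiCompact f → IsIntegral X → ∀ (Z : Scheme.{0}) (ι : Z ⟶ pullback f (Spec.map (CommRingCat.ofHom (algebraMap k K)))), IsClosedImmersion ι → Surjective ι → IsReduced Z → Scheme.HasResolution Z → Scheme.HasResolution X) → (∀ (k K : Type) [Field k] [Field K] [Algebra k K] [CharP k p] (a : k) (α : K), (∀ b : k, b ^ p ≠ a) → α ^ p = algebraMap k K a → IntermediateField.adjoin k {α} = ⊤ → ∀ (X : Scheme.{0})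 (f : X ⟶ Spec (.of k)), IsSeparated f → LocallyOfFiniteType f → QuasiCompact f → IsReduced X → ∀ (Z : Scheme.{0}) (ι : Z ⟶ pullback f (Spec.map (CommRingCat.ofHom (algebraMap k K)))), IsClosedImmersion ι → Surjective ι → IsReduced Z → Scheme.HasResolution Z → Scheme.HasResolution X) := by
  intro p _ hint k K _ _ _ _ a α ha hα htop X f hsep hlft hqc hred Z ι hι hsurj hZred hZ
  haveI := hsep; haveI := hlft; haveI := hqc; haveI := hred; haveI := hι; haveI := hsurj
  haveI := hZred
  haveI : IsPurelyInseparable k K := isPurelyInseparable_of_pow_eq a α hα htop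
  haveI := universallyClosed_SpecMap_of_isPurelyInseparable k K
  haveI := universallyInjective_SpecMap_of_isPurelyInseparable k K
  exact hasResolution_of_forall_isIntegral_of_radicial (Spec.map (CommRingCat.ofHom (algebraMap k K)))
    (hint k K a α ha hα htop) X f ι hZ

end Summit.ResolutionOfSingularities.ResolutionOfSingularities.Theorems

end
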